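import Mathlib
import HarnessLib
import Summits.AtomisticToContinuum.BoseEinsteinCondensation.Theses.BECPhaseQuadratureSumRule

/-!
# Birth skeleton (BC3) for crux `NonCondensateRemainders` (stmt-AtomisticToContinuum-12615)

Route `route-AtomisticToContinuum-BECPhaseQuadratureSumRule` (sub-problem `BoseEinsteinCondensation`); crux decl
`Summit.AtomisticToContinuum.BoseEinsteinCondensation.Theses.BECPhaseQuadratureSumRule.NonCondensateRemainders`
(FIXED — rank 2: for the torus minimiser `Ψ` of `−Σ∆ⱼ + tΣv^per`, `t ∈ (0,1]`, `L = (N/ρ)^{1/3}`, the infrared sum over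
`0 < |k| < Λ√(ρa)` of `‖A_k^{nc}Ψ‖²/|k|⁴ + ‖ρ_k^{nc†}Ψ‖²` is `≤ εN²` for `ρ < ρ₀(Λ,ε)` and `N` large).

**The line (the route's own foreseen glued split, TWO-LAYER PLAN of the route header):** the crux is the SUM of two
remainders that are small for two DIFFERENT structural reasons, so it is cut along that seam —

* `stub_currentRemainder` (**S1, the HARDEST stub; XL / open**): the summed non-condensate CURRENT remainder
  `Σ_{0<|k|<Λ√(ρa)} ‖A_k^{nc}Ψ‖²/|k|⁴ ≤ εN²`, `A_k^{nc} = Σⱼ Qⱼ e^{ik·xⱼ}(−2ik·∇ⱼ + |k|²) Qⱼ` (cell-average form). Bogoliubov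
  size `O(|k|⁴N√(ρa³))` per mode by the PAIR-CURRENT CANCELLATION `(u_p v_q − v_p u_q)² → 0` as `k → 0` (momentum
  conservation; Stringari1995 §2.3, GavoretNozieres1964), summed `O(Λ³ρa³N²)`; the declared risk is a `log L` (d = 3
  marginality of the Bogoliubov series, barrier `Literature.Barriers.AtomisticToContinuum.BogoliubovPerturbationInfrared`).
* `stub_densityRemainder` (**S2; XL / open**): the summed non-condensate DENSITY remainder
  `Σ_{0<|k|<Λ√(ρa)} ‖ρ_k^{nc†}Ψ‖² ≤ εN²`, `ρ_k^{nc†} = Σⱼ Qⱼ e^{ik·xⱼ} Qⱼ`: a static 4-point function of the depletion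
  (Bogoliubov `½Σ_p(u_p v_{p+k} + v_p u_{p+k})² = O(N√(ρa³))` per mode, flat in `k`; mode count `Λ³√(ρa³)N/(6π²)`), no
  cancellation needed but also no a-priori handle beyond `N₊ ≤ C N√(ρa³)`-type depletion bounds (LiebSeiringerYngvason2005
  justifies the c-number substitution for the pressure only).

**Composition** `NonCondensateRemainders_of` (real proof, no `sorry`): run both stubs at `ε/2`, take `ρ₀ := min ρ₁ ρ₂`,
intersect the two `∀ᶠ N` events, split `∑' n, 1_S(n)·(a n + b n) = ∑' 1_S·a + ∑' 1_S·b` (`ENNReal.tsum_add`) and add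
`ENNReal.ofReal (ε/2·N²) + ENNReal.ofReal (ε/2·N²) = ENNReal.ofReal (ε·N²)`. `NonCondensateRemainders_proof` is the
composition applied to the sorried stubs. The statements of the stubs are spelled twice — inline on the `stub_*` theorems
(so the registered signatures are self-contained over `Literature…BoseGas` + Mathlib) and as the `Goal.stub_*` abbrevs that
type the hypotheses of `NonCondensateRemainders_of` (skeleton-audit shape: hypotheses = declared stubs by name).

**Disproof.lean / dead lines honoured:** none exist for this crux at registration (`ledger crux ls` 2026-08-17: no
workfiles); the refuter crux-attack (EVIDENCE.md, 2026-08-15) found the degenerate branch `a(v) = 0` benign (IR window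
empty) — both stubs inherit it verbatim (same window, same hypotheses). Negatives index (BEC: SwapJensen) not touched.

**BC3 probes (planner folder `bc/probe_*.lean`, 2026-08-17):** for each stub `S`, `S → NonCondensateRemainders` and
`S → _root_.BoseEinsteinCondensation` by `first | exact? | simpa | aesop` (+ unfold variants) FAIL — neither stub is
cheaply the crux or the summit.
-/

namespace Summit.AtomisticToContinuum.BoseEinsteinCondensation.Cruxes.NonCondensateRemainders.Birth

open scoped BigOperators ENNReal
open Filter MeasureTheory
open Literature.MathematicalPhysics.QuantumManyBody.BoseGas
open Summit.AtomisticToContinuum.BoseEinsteinCondensation.Theses.BECPhaseQuadratureSumRule (NonCondensateRemainders)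

/-! ## §1 Statements of the stubs (the `Goal` abbrevs type the hypotheses of `NonCondensateRemainders_of`) -/

namespace Goal

/-- Statement of S1 `stub_currentRemainder`: the summed non-condensate current remainder is `≤ εN²`. -/
abbrev stub_currentRemainder : Prop :=
  open Literature.MathematicalPhysics.QuantumManyBody.BoseGas in ∀ v : ℝ → ENNReal, IsRepulsiveFiniteRange v → (∀ r, v r ≠ ⊤) → ContDiff ℝ 2 (fun x : Space => (v ‖x‖).toReal) → (∃ Cₑ : ℝ, ∀ x : Space, ‖iteratedFDeriv ℝ 2 (fun x : Space => (v ‖x‖).toReal) x‖ ≤ Cₑ * Real.sqrt ((v ‖x‖).toReal)) → ∀ Λ : ℝ, 0 < Λ → ∀ ε : ℝ, 0 < ε → ∃ ρ₀ : ℝ, 0 < ρ₀ ∧ ∀ ρ : ℝ, 0 < ρ → ρ < ρ₀ → ∀ᶠ N : ℕ in Filter.atTop, ∀ t : ℝ, 0 < t → t ≤ 1 → ∀ Ψ : PeriodicTrialState N (sideLength ρ N), (let L : ℝ := sideLength ρ N; let w : ℝ → ENNReal := fun r => ENNReal.ofReal t * v r; periodicEnergy w Ψ = periodicGroundStateEnergy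 w N L → periodicEnergy w Ψ ≠ ⊤ → (∑' n : Fin 3 → ℤ, {n : Fin 3 → ℤ | n ≠ 0 ∧ ‖((2 * Real.pi / L) • latticeVec 1 n)‖ < Λ * Real.sqrt (ρ * (scatteringLength v).toReal)}.indicator (fun n => (∫⁻ X in cellN N L, (‖∑ j : Fin N, (cellWave L n (X j) * ((-2 * Complex.I) * fderiv ℝ Ψ.ψ X (Pi.single j ((2 * Real.pi / L) • latticeVec 1 n)) + (((‖((2 * Real.pi / L) • latticeVec 1 n)‖ ^ 2 : ℝ)) : ℂ) * (Ψ.ψ X - (((L ^ 3)⁻¹ : ℝ) : ℂ) * ∫ y in cell L, Ψ.ψ (Function.update X j y))) + (((‖((2 * Real.pi / L) • latticeVec 1 n)‖ ^ 2 : ℝ)) : ℂ) * ((((L ^ 3)⁻¹ : ℝ) : ℂ) * ∫ y in cell L, cellWave L n y * Ψ.ψ (Function.update X j y)))‖₊ : ENNReal) ^ 2) / ENNReal.ofReal (‖((2 * Real.pi / L) • latticeVec 1 n)‖ ^ 4)) n) ≤ ENNReal.ofReal (ε * (N : ℝ) ^ 2))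

/-- Statement of S2 `stub_densityRemainder`: the summed non-condensate density remainder is `≤ εN²`. -/
abbrev stub_densityRemainder : Prop :=
  open Literature.MathematicalPhysics.QuantumManyBody.BoseGas in ∀ v : ℝ → ENNReal, IsRepulsiveFiniteRange v → (∀ r, v r ≠ ⊤) → ContDiff ℝ 2 (fun x : Space => (v ‖x‖).toReal) → (∃ Cₑ : ℝ, ∀ x : Space, ‖iteratedFDeriv ℝ 2 (fun x : Space => (v ‖x‖).toReal) x‖ ≤ Cₑ * Real.sqrt ((v ‖x‖).toReal)) → ∀ Λ : ℝ, 0 < Λ → ∀ ε : ℝ, 0 < ε → ∃ ρ₀ : ℝ, 0 < ρ₀ ∧ ∀ ρ : ℝ, 0 < ρ → ρ < ρ₀ → ∀ᶠ N : ℕ in Filter.atTop, ∀ t : ℝ, 0 < t → t ≤ 1 → ∀ Ψ : PeriodicTrialState N (sideLength ρ N), (let L : ℝ := sideLength ρ N; let w : ℝ → ENNReal := fun r => ENNReal.ofReal t * v r; periodicEnergy w Ψ = periodicGroundStateEnergy w N L → periodicEnergy w Ψ ≠ ⊤ → (∑' n : Fin 3 → ℤ, {n : Fin 3 → ℤ |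 n ≠ 0 ∧ ‖((2 * Real.pi / L) • latticeVec 1 n)‖ < Λ * Real.sqrt (ρ * (scatteringLength v).toReal)}.indicator (fun n => (∫⁻ X in cellN N L, (‖∑ j : Fin N, (cellWave L n (X j) * (Ψ.ψ X - (((L ^ 3)⁻¹ : ℝ) : ℂ) * ∫ y in cell L, Ψ.ψ (Function.update X j y)) - (((L ^ 3)⁻¹ : ℝ) : ℂ) * ∫ y in cell L, cellWave L n y * Ψ.ψ (Function.update X j y))‖₊ : ENNReal) ^ 2)) n) ≤ ENNReal.ofReal (ε * (N : ℝ) ^ 2))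

end Goal

/-! ## §2 Registered stubs (the ONLY `sorry`s of this file) -/

/-- **S1 (XL / open; the HARDEST stub — pair-current cancellation for the true minimiser)**: for the torus minimiser
`Ψ` of `−Σ∆ⱼ + tΣv^per` (`t ∈ (0,1]`, `L = (N/ρ)^{1/3}`, `ρ < ρ₀(Λ,ε)`, `N` large),
`Σ_{0<|k|<Λ√(ρa)} ‖Σⱼ Qⱼe^{ik·xⱼ}(−2ik·∇ⱼ+|k|²)QⱼΨ‖² / |k|⁴ ≤ εN²`. [Stringari1995 §2.3; GavoretNozieres1964;
LiebSeiringerYngvason2005] -/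
theorem stub_currentRemainder : open Literature.MathematicalPhysics.QuantumManyBody.BoseGas in ∀ v : ℝ → ENNReal, IsRepulsiveFiniteRange v → (∀ r, v r ≠ ⊤) → ContDiff ℝ 2 (fun x : Space => (v ‖x‖).toReal) → (∃ Cₑ : ℝ, ∀ x : Space, ‖iteratedFDeriv ℝ 2 (fun x : Space => (v ‖x‖).toReal) x‖ ≤ Cₑ * Real.sqrt ((v ‖x‖).toReal)) → ∀ Λ : ℝ, 0 < Λ → ∀ ε : ℝ, 0 < ε → ∃ ρ₀ : ℝ, 0 < ρ₀ ∧ ∀ ρ : ℝ, 0 < ρ → ρ < ρ₀ → ∀ᶠ N : ℕ in Filter.atTop, ∀ t : ℝ, 0 < t → t ≤ 1 → ∀ Ψ : PeriodicTrialState N (sideLength ρ N), (let L : ℝ := sideLength ρ N; let w : ℝ → ENNReal := fun r => ENNReal.ofReal t * v r; periodicEnergy w Ψ = periodicGroundStateEnergy w N L → periodicEnergy w Ψ ≠ ⊤ → (∑' n : Fin 3 → ℤ, {n : Fin 3 → ℤ | n ≠ 0 ∧ ‖((2 * Real.pi / L) • latticeVec 1 n)‖ < Λ * Real.sqrt (ρ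 * (scatteringLength v).toReal)}.indicator (fun n => (∫⁻ X in cellN N L, (‖∑ j : Fin N, (cellWave L n (X j) * ((-2 * Complex.I) * fderiv ℝ Ψ.ψ X (Pi.single j ((2 * Real.pi / L) • latticeVec 1 n)) + (((‖((2 * Real.pi / L) • latticeVec 1 n)‖ ^ 2 : ℝ)) : ℂ) * (Ψ.ψ X - (((L ^ 3)⁻¹ : ℝ) : ℂ) * ∫ y in cell L, Ψ.ψ (Function.update X j y))) + (((‖((2 * Real.pi / L) • latticeVec 1 n)‖ ^ 2 : ℝ)) : ℂ) * ((((L ^ 3)⁻¹ : ℝ) : ℂ) * ∫ y in cell L, cellWave L n y * Ψ.ψ (Function.update X j y)))‖₊ : ENNReal) ^ 2) / ENNReal.ofReal (‖((2 * Real.pi / L) • latticeVec 1 n)‖ ^ 4)) n) ≤ ENNReal.ofReal (ε * (N : ℝ) ^ 2)) := by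
  sorry

/-- **S2 (XL / open — static depletion structure)**: for the same minimisers,
`Σ_{0<|k|<Λ√(ρa)} ‖Σⱼ Qⱼe^{ik·xⱼ}QⱼΨ‖² ≤ εN²`. [LiebSeiringerYngvason2005; Griffin1993 Ch. 5–6] -/
theorem stub_densityRemainder : open Literature.MathematicalPhysics.QuantumManyBody.BoseGas in ∀ v : ℝ → ENNReal, IsRepulsiveFiniteRange v → (∀ r, v r ≠ ⊤) → ContDiff ℝ 2 (fun x : Space => (v ‖x‖).toReal) → (∃ Cₑ : ℝ, ∀ x : Space, ‖iteratedFDeriv ℝ 2 (fun x : Space => (v ‖x‖).toReal) x‖ ≤ Cₑ * Real.sqrt ((v ‖x‖).toReal)) → ∀ Λ : ℝ, 0 < Λ → ∀ ε : ℝ, 0 < ε → ∃ ρ₀ : ℝ, 0 < ρ₀ ∧ ∀ ρ : ℝ, 0 < ρ → ρ < ρ₀ → ∀ᶠ N : ℕ in Filter.atTop, ∀ t : ℝ, 0 < t → t ≤ 1 → ∀ Ψ : PeriodicTrialState N (sideLength ρ N), (let L : ℝ := sideLength ρ N; let w : ℝ → ENNReal := fun r => ENNReal.ofReal t * v r; periodicEnergy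 w Ψ = periodicGroundStateEnergy w N L → periodicEnergy w Ψ ≠ ⊤ → (∑' n : Fin 3 → ℤ, {n : Fin 3 → ℤ | n ≠ 0 ∧ ‖((2 * Real.pi / L) • latticeVec 1 n)‖ < Λ * Real.sqrt (ρ * (scatteringLength v).toReal)}.indicator (fun n => (∫⁻ X in cellN N L, (‖∑ j : Fin N, (cellWave L n (X j) * (Ψ.ψ X - (((L ^ 3)⁻¹ : ℝ) : ℂ) * ∫ y in cell L, Ψ.ψ (Function.update X j y)) - (((L ^ 3)⁻¹ : ℝ) : ℂ) * ∫ y in cell L, cellWave L n y * Ψ.ψ (Function.update X j y))‖₊ : ENNReal) ^ 2)) n) ≤ ENNReal.ofReal (ε * (N : ℝ) ^ 2)) := by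
  sorry

/-! ## §3 Composition (real proofs; no `sorry` below this line) -/

/-- Splitting the `tsum` of an indicator of a pointwise sum in `ℝ≥0∞`. [folklore] -/
theorem tsum_indicator_add {ι : Type*} (S : Set ι) (A B : ι → ℝ≥0∞) :
    (∑' n, S.indicator (fun n => A n + B n) n) = (∑' n, S.indicator A n) + ∑' n, S.indicator B n :=
  calc (∑' n, S.indicator (fun n => A n + B n) n)
      = ∑' n, (S.indicator A n + S.indicator B n) := tsum_congr fun n => by
          by_cases hn : n ∈ S <;> simp [hn]
    _ = (∑' n, S.indicator A n) + ∑' n, S.indicator B n := ENNReal.tsum_add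

/-- `ofReal (ε/2·x) + ofReal (ε/2·x) = ofReal (ε·x)` for `ε, x ≥ 0`. [folklore] -/
theorem ofReal_half_add_half (ε x : ℝ) (hε : 0 ≤ ε) (hx : 0 ≤ x) :
    ENNReal.ofReal (ε / 2 * x) + ENNReal.ofReal (ε / 2 * x) = ENNReal.ofReal (ε * x) := by
  rw [← ENNReal.ofReal_add (by positivity) (by positivity)]
  congr 1
  ring

/-- **The crux from the two registered stubs** (glue shape: hypotheses = the stubs by name, conclusion = the route decl
BY NAME): both stubs at `ε/2`, `ρ₀ := min ρ₁ ρ₂`, intersection of the two eventual events, `tsum_indicator_add`,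
`ofReal_half_add_half`. [folklore] -/
theorem NonCondensateRemainders_of (hA : Goal.stub_currentRemainder) (hD : Goal.stub_densityRemainder) :
    NonCondensateRemainders := by
  intro v hv hfin hC2 hedge Λ hΛ ε hε
  obtain ⟨ρ₁, hρ₁, h₁⟩ := hA v hv hfin hC2 hedge Λ hΛ (ε / 2) (half_pos hε)
  obtain ⟨ρ₂, hρ₂, h₂⟩ := hD v hv hfin hC2 hedge Λ hΛ (ε / 2) (half_pos hε)
  refine ⟨min ρ₁ ρ₂, lt_min hρ₁ hρ₂, fun ρ hρ hρ₀ => ?_⟩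
  filter_upwards [h₁ ρ hρ (lt_of_lt_of_le hρ₀ (min_le_left _ _)),
    h₂ ρ hρ (lt_of_lt_of_le hρ₀ (min_le_right _ _))] with N hN₁ hN₂
  intro t ht ht₁ Ψ
  have hA' := hN₁ t ht ht₁ Ψ
  have hD' := hN₂ t ht ht₁ Ψ
  dsimp only at hA' hD' ⊢
  intro hE hfinE
  refine (tsum_indicator_add _ _ _).trans_le ?_
  refine (add_le_add (hA' hE hfinE) (hD' hE hfinE)).trans_eq ?_
  exact ofReal_half_add_half ε _ hε.le (by positivity)

/-- The skeleton applied to the (sorried) stubs: `NonCondensateRemainders` modulo exactly S1, S2. -/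
theorem NonCondensateRemainders_proof : NonCondensateRemainders :=
  NonCondensateRemainders_of stub_currentRemainder stub_densityRemainder

end Summit.AtomisticToContinuum.BoseEinsteinCondensation.Cruxes.NonCondensateRemainders.Birth
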